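import Summits.PneNP.PneNP.Theses.ExpanderLinearGenerators
import Literature.Computability.FineGrained.SatAlgorithmsTautProofs
import Literature.Computability.Complexity.NPClosureProofs
import Literature.Computability.Complexity.NPEqUnionNTIME
import Literature.Computability.Complexity.ProofComplexityNP

/-!
# PneNP / ExpanderLinearGenerators — the target `NoPolyBoundedProofSystem` (stmt-PneNP-0097) follows from NSETH

Item `stmt-PneNP-0097` (shared target of the routes ProofCplx, AperiodicTorus, LyapunovRefutations,
MatroidTseitin, ExpanderLinearGenerators) is Cook–Reckhow's form of `NP ≠ coNP`:
`X := ¬ HasPolyBoundedProofSystem TAUT` (no Cook–Reckhow proof system for `TAUT` is polynomially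
bounded). It is an open problem (Krajíček 2019, Problem 1.5.3). This file does NOT settle it; it
lands, as support for the item, the implication

  `NSETH → X`

from the tree's registered open conjecture `Literature.Computability.FineGrained.NSETH`
(Carmosino–Gao–Impagliazzo–Mihajlin–Paturi–Schneider, ITCS 2016, §1: for every `ε > 0` some
`k`-TAUT is not in NTIME(`2^{(1-ε) n}`)), i.e. the folklore remark that NSETH is a (much) stronger
form of `NP ≠ coNP`: if `TAUT ∈ NP` then every `k`-TAUT is in NTIME(`poly(L)`) ⊆
NTIME(`2^{δ n} · poly(L)`) for every `δ ≥ 0`, refuting NSETH at `ε = 1/2`.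

Proof architecture (no Turing machine is written; everything is assembled from the tree):

* the Karp map `g := asm ∘ tautFST.eval ∘ transFn` (`SatAlgorithmsTautProofs.lean`,
  `SatAlgorithmsProofs.lean`) sends the Boolean code `KCNF.encodeBool φ` of a `k`-clause list `φ`
  to the `TAUT`-codeword of `¬ ⋀ (negate φ)`, a tautology iff `φ` read as a `k`-DNF is one
  (`transFn_encodeBool`, `asm_tautFST_eval`, `isTautology_negForm_iff`,
  `isDNFTautology_iff_not_satisfiable_negate`); it is polynomial time by
  `PolyTimeComputable.comp_holds`;
* `g ⁻¹' TAUT ∈ NP` (`preimage_mem_NP`), hence `∈ NTIME(n^j)` for some `j` in the tree's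
  one-constant verifier form (`NP_subset_iUnion_NTIME`), which is verbatim the machine clause of
  `KTAUTInNExpTime k δ` with budget `T n L := c · L^j + c`, an `IsExpPolyBound δ` budget for `δ ≥ 0`;
* `TAUT ∈ coNP` (`TAUT_mem_coNP_holds`) gives `NSETH → NP ≠ coNP`, and Cook–Reckhow's Prop. 1.1
  `NP = coNP ↔ HasPolyBoundedProofSystem TAUT` (`NP_eq_coNP_iff_hasPolyBoundedProofSystem_TAUT_holds`;
  cf. `noPolyBoundedProofSystem_iff_NP_ne_coNP` in the companion file
  `ExpanderLinearGeneratorsNoPolyBoundedProofSystem.lean`, which records `X ↔ NP ≠ coNP` for this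
  item) turns it into `NSETH → X`.

Companion of `ExpanderLinearGeneratorsNoPolyBoundedProofSystem.lean` (kept separate so that the base
file does not import the fine-grained machine library).
Prover prover-PneNP-route-PneNP-ExpanderLinearGenerators-1, 2026-08-16.
-/

set_option linter.dupNamespace false

namespace Summit.PneNP.PneNP.Theorems

open Literature.Computability.Complexity Literature.Computability.FineGrained
open Literature.Computability.MetaComplexity

/-- A budget `c · L^j + c` (polynomial in the code length, constant in the number of variables) is
an `IsExpPolyBound δ` budget for every `δ ≥ 0`: `c L^j + c ≤ (2c + j) · 2^{δ n} · (L + 1)^{2c + j}`.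
[folklore] -/
theorem isExpPolyBound_const_mul_pow_add (c j : ℕ) {δ : ℝ} (hδ : 0 ≤ δ) :
    IsExpPolyBound δ (fun _ L => c * L ^ j + c) := by
  refine ⟨2 * c + j, fun n L => ?_⟩
  have hL0 : (0 : ℝ) ≤ (L : ℝ) := Nat.cast_nonneg L
  have hL1 : (1 : ℝ) ≤ (L : ℝ) + 1 := by linarith
  have h2 : (1 : ℝ) ≤ (2 : ℝ) ^ (δ * n) := Real.one_le_rpow one_le_two (by positivity)
  have hpow1 : (L : ℝ) ^ j ≤ ((L : ℝ) + 1) ^ j := by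
    gcongr
    linarith
  have hpow2 : ((L : ℝ) + 1) ^ j ≤ ((L : ℝ) + 1) ^ (2 * c + j) :=
    pow_le_pow_right₀ hL1 (by omega)
  have hone : (1 : ℝ) ≤ ((L : ℝ) + 1) ^ (2 * c + j) := one_le_pow₀ hL1
  have hc0 : (0 : ℝ) ≤ (c : ℝ) := Nat.cast_nonneg c
  have hA : (c : ℝ) * (L : ℝ) ^ j ≤ c * ((L : ℝ) + 1) ^ (2 * c + j) :=
    mul_le_mul_of_nonneg_left (hpow1.trans hpow2) hc0
  have hB : (c : ℝ) ≤ c * ((L : ℝ) + 1) ^ (2 * c + j) := le_mul_of_one_le_right hc0 hone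
  have hpos : (0 : ℝ) ≤ ((L : ℝ) + 1) ^ (2 * c + j) := by positivity
  push_cast
  calc (c : ℝ) * (L : ℝ) ^ j + c
      ≤ 2 * c * ((L : ℝ) + 1) ^ (2 * c + j) := by linarith
    _ ≤ (2 * c + j : ℝ) * ((L : ℝ) + 1) ^ (2 * c + j) := by
        gcongr
        linarith [(Nat.cast_nonneg j : (0 : ℝ) ≤ j)]
    _ = (2 * c + j : ℝ) * 1 * ((L : ℝ) + 1) ^ (2 * c + j) := by ring
    _ ≤ (2 * c + j : ℝ) * (2 : ℝ) ^ (δ * n) * ((L : ℝ) + 1) ^ (2 * c + j) := by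
        gcongr

/-- **`TAUT ∈ NP` puts every `k`-TAUT in NTIME(`2^{δ n} · poly(L)`) for every `δ ≥ 0`** (indeed in
nondeterministic polynomial time `poly(L)`): the Boolean code of a `k`-clause list `φ` is sent by the
polynomial-time map `g = asm ∘ tautFST.eval ∘ transFn` to the `TAUT`-codeword of `¬ ⋀ (negate φ)`,
which is a tautology iff `φ` is a `k`-DNF tautology; so the `k`-TAUT codewords are exactly the
codewords in `g ⁻¹' TAUT ∈ NP ⊆ ⋃ⱼ NTIME(nʲ)`, and the one-constant verifier of `NTIME(nʲ)` is a
`KTAUTInNExpTime` verifier with budget `c · L^j + c`. (Carmosino et al. 2016, §1, for the class;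
Arora–Barak 2009, Thm. 2.6 and Thm. 2.8 for `NP ⊆ ⋃ NTIME(nᵏ)` and closure under reductions.)
[folklore] -/
theorem kTAUTInNExpTime_of_TAUT_mem_NP (hT : TAUT ∈ Nondeterministic.NP) (k : ℕ) {δ : ℝ}
    (hδ : 0 ≤ δ) : KTAUTInNExpTime k δ := by
  -- the reduction and its polynomial running time
  set g : List Bool → List Bool := SatTaut.asm ∘ (SatTaut.tautFST.eval ∘ KTaut.transFn) with hg_def
  have hg : g ∈ FP :=
    PolyTimeComputable.comp_holds SatTaut.asm_mem_FP
      (PolyTimeComputable.comp_holds SatTaut.tautFST.polyTimeComputable_eval KTaut.polyTime_transFn)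
  -- what it computes on codewords
  have hg_enc : ∀ φ : KCNF k,
      g φ.encodeBool = encodingPropForm.encode (SatTaut.negForm (KTaut.negate φ)) := by
    intro φ
    simp only [hg_def, Function.comp_apply, KTaut.transFn_encodeBool, SatTaut.asm_tautFST_eval]
  have hmem : ∀ φ : KCNF k, φ.encodeBool ∈ g ⁻¹' TAUT ↔ φ.IsDNFTautology := by
    intro φ
    rw [Set.mem_preimage, hg_enc]
    change encodingPropForm.encode (SatTaut.negForm (KTaut.negate φ)) ∈ TAUT ↔ _
    rw [mem_TAUT_iff, SatTaut.isTautology_negForm_iff,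
      KTaut.isDNFTautology_iff_not_satisfiable_negate]
  -- `g ⁻¹' TAUT ∈ NP ⊆ ⋃ⱼ NTIME(nʲ)`
  have hNP : g ⁻¹' TAUT ∈ Nondeterministic.NP := preimage_mem_NP hT hg
  obtain ⟨j, hj⟩ := Set.mem_iUnion.1 (NP_subset_iUnion_NTIME hNP)
  obtain ⟨c, R, M, hM, hR⟩ := hj
  refine ⟨fun _ L => c * L ^ j + c, fun φ y => R φ.encodeBool y, M,
    isExpPolyBound_const_mul_pow_add c j hδ, fun φ y hy => hM φ.encodeBool y hy, fun φ => ?_⟩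
  exact (hmem φ).symm.trans (hR φ.encodeBool)

/-- **Under NSETH, `TAUT ∉ NP`** (contrapositive: `TAUT ∈ NP` puts every `k`-TAUT in
NTIME(`2^{n/2} · poly(L)`), refuting NSETH at `ε = 1/2`). [folklore] -/
theorem TAUT_not_mem_NP_of_nseth (h : NSETH) : TAUT ∉ Nondeterministic.NP := fun hT => by
  obtain ⟨k, -, hk⟩ := h (1 / 2) one_half_pos
  exact hk (kTAUTInNExpTime_of_TAUT_mem_NP hT k (by norm_num))

/-- `NP = coNP` gives `TAUT ∈ NP` (`TAUT ∈ coNP`, `TautMachine.lean`). (Arora–Barak 2009,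
Example 2.21 and §2.6.1.) [folklore] -/
theorem TAUT_mem_NP_of_NP_eq_coNP (h : Nondeterministic.NP = coNP) :
    TAUT ∈ Nondeterministic.NP := by
  have h₁ : TAUTᶜ ∈ Nondeterministic.NP := TAUT_mem_coNP_holds
  rw [h] at h₁
  have h₂ : TAUTᶜᶜ ∈ Nondeterministic.NP := h₁
  rwa [compl_compl] at h₂

/-- **NSETH implies `NP ≠ coNP`** (NSETH is a strengthening of `NP ≠ coNP`: Carmosino et al.,
ITCS 2016, §1). [folklore] -/
theorem NP_ne_coNP_of_nseth (h : NSETH) : Nondeterministic.NP ≠ coNP :=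
  fun he => TAUT_not_mem_NP_of_nseth h (TAUT_mem_NP_of_NP_eq_coNP he)

/-- **NSETH implies that `TAUT` has no polynomially bounded Cook–Reckhow proof system** (via
Cook–Reckhow's Prop. 1.1, `NP = coNP ↔ HasPolyBoundedProofSystem TAUT`,
`NP_eq_coNP_iff_hasPolyBoundedProofSystem_TAUT_holds`). Route-independent statement of the bridge
(the five routes' targets are this proposition verbatim). [folklore] -/
theorem not_hasPolyBoundedProofSystem_TAUT_of_nseth (h : NSETH) :
    ¬ HasPolyBoundedProofSystem TAUT := fun hp => by
  have h11 : Nondeterministic.NP = coNP ↔ HasPolyBoundedProofSystem TAUT :=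
    NP_eq_coNP_iff_hasPolyBoundedProofSystem_TAUT_holds
  exact NP_ne_coNP_of_nseth h (h11.2 hp)

/-- **Support for `stmt-PneNP-0097`** (route ExpanderLinearGenerators, decl `NoPolyBoundedProofSystem`,
the shared target `X = ¬ HasPolyBoundedProofSystem TAUT`): the registered open conjecture NSETH
implies `X`. (`X` itself is Cook–Reckhow's `NP ≠ coNP`, open; this is a conditional bridge, not a
proof of the item.) [folklore] -/
theorem noPolyBoundedProofSystem_of_nseth (h : NSETH) :
    Summit.PneNP.PneNP.Theses.ExpanderLinearGenerators.NoPolyBoundedProofSystem := by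
  unfold Summit.PneNP.PneNP.Theses.ExpanderLinearGenerators.NoPolyBoundedProofSystem
  exact not_hasPolyBoundedProofSystem_TAUT_of_nseth h

end Summit.PneNP.PneNP.Theorems
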